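import Summits.Schanuel.Schanuel.Theorems.RootDecomp1KGeneric11
import Summits.Schanuel.Schanuel.Theorems.RootDecomp1KGeneric07

/-!
# RootDecomp1K — «GENERIC CELLS», part 12: Piece KS (Kummer specialisation) — ASSEMBLY: A₄ʰ from NW96 + the level-3 residual + the storeys n ≥ 4

Provenance: ROOT DECOMPOSITION CELL decomp-schanuel (D-0178), lens 6 «barrier-complement carving»,
gen 13, Stage D; source `KS.lean` (lens publication dir `decomp-schanuel-lens-6/g13/addendum/`).
Supports `stmt-Schanuel-33363` (A₄ʰ `HyperLiouvilleSchanuel`) via the glued split of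
`Theorems/RootDecomp1KGeneric02` (`hyperLiouvilleSchanuel_live_of_pieces`): this series of parts 08–11
PROVES Piece KS (`KummerSpecialisation`, `@[conjecture] def` of part 01) outright.

Contents: the proved pieces KS (part 11) and CF (part 07) discharged in the glued split
`hyperLiouvilleSchanuel_live_of_pieces` of part 02.
-/

noncomputable section

open Complex Polynomial

namespace Summit.Schanuel.Schanuel.Theorems.RootDecomp1KGeneric

open Summit.Schanuel.Schanuel.Theorems.RootDecomp1KHyper
open Summit.Schanuel.Schanuel.Theorems.RootDecomp1KHyper.HyperCell
open Literature.NumberTheory.Transcendental (NesterenkoWaldschmidt1996_thm_1)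

/-- **A₄ʰ live target from the cited theorem NW96, the level-3 residual and the storeys `n ≥ 4`**:
both attackable pieces KS and CF of the glued split (part 02) are now theorems. -/
theorem hyperLiouvilleSchanuel_live_of_residuals
    (hNW : NesterenkoWaldschmidt1996_thm_1)
    (hR : Rank3HyperResidual) (h4 : HyperStoreyFrom4) :
    Summit.Schanuel.Schanuel.Theses.RootDecomp1K.HyperLiouvilleSchanuel :=
  hyperLiouvilleSchanuel_live_of_pieces hNW kummerSpecialisation_holds cylinderFunnelWeak hR h4

/-- **Every line cell of A₄ʰ, mod NW96 alone.**  For `u ≠ 0`, `ρ` hyper-Liouville and any `w`: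
`SB 2 (u, ρu)` and `SB 3 (u, ρu, w)` (part 02 `hyperCell_any` with KS and CF discharged). -/
theorem hyperCell_any_of_NW (hNW : NesterenkoWaldschmidt1996_thm_1) {u : ℂ} (hu0 : u ≠ 0) {ρ : ℝ}
    (hρ : HyperLiouville ρ) (w : ℂ) : SB 2 ![u, (ρ : ℂ) * u] ∧ SB 3 ![u, (ρ : ℂ) * u, w] :=
  hyperCell_any hNW kummerSpecialisation_holds cylinderFunnelWeak hu0 hρ w

/-- **A ℚ-free triple with a hyper-Liouville ratio has `SB 3`, mod NW96 alone.** -/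
theorem sb_three_of_hlRatio_of_NW (hNW : NesterenkoWaldschmidt1996_thm_1) {z : Fin 3 → ℂ}
    (hz : LinearIndependent ℚ z) (hr : HasHLRatio z) : SB 3 z :=
  sb_three_of_hlRatio hNW kummerSpecialisation_holds cylinderFunnelWeak hz hr

/-- **EXACTNESS mod NW96 alone.**  The level-3 storey of A₄ʰ is exactly the typed rank-3 residual.
(Writer-1 g12 `GaugeResidual.lean`: `HasHLRatio` is not `GL₃(ℤ)`-invariant, and the residual of record should be
the span-level `Rank3SpanResidual`, equivalent to `Rank3HyperResidual` mod NW96 + KS + CF — hence, by this file,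
mod NW96 alone.) -/
theorem level3_iff_rank3_of_NW (hNW : NesterenkoWaldschmidt1996_thm_1) :
    (∀ z : Fin 3 → ℂ, LinearIndependent ℚ z → HyperLinLiouville z → SB 3 z) ↔ Rank3HyperResidual :=
  level3_iff_rank3 hNW kummerSpecialisation_holds cylinderFunnelWeak

end Summit.Schanuel.Schanuel.Theorems.RootDecomp1KGeneric
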